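import Mathlib
import HarnessLib
import Literature.MathematicalPhysics.StatisticalMechanics.FluctuationOfHamiltonian
import Literature.MathematicalPhysics.StatisticalMechanics.StepOperatorBABKM
import Summits.HubbardSuperconductivity.HubbardSuperconductivity.Theorems.ComplexGFFStiffnessHypACumulantHolomorphicMidK

/-!
# Crux `HypACumulant`, line `gnv` — structural pass, brick S5: the next Hamiltonian `H̃ = nextH D H K`
# is AFFINE along the complex line `(H + σU, K + σV)`

Route `route-HubbardSuperconductivity-ComplexGFFStiffness`, cruxes stmt-HubbardSuperconductivity-19154 /
-19155, shared research statement `OnePointLipschitz`, census (C3d′) (memo §7, step S5).  Since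
`nextH D H K = A_k H + B_k K` (`nextH_eq`, [ABKM19] (6.55)–(6.57)) with `A_k` linear and
`B_k K = −Π₂ R_{k+1} K(B₀)` additive and homogeneous on integrable `C²` data:

* `Pi2_const_mul_of_contDiff` — `Π₂(σ·F) = σ • Π₂ F` for `C²` functionals;
* `fluct_const_mul` — `R(σ·F) = σ·RF`;
* `opB_line` — `B_k (K + σV) = B_k K + σ • B_k V` (under integrability of `K(B₀,φ+·)`, `V(B₀,φ+·)` and
  `C²` of their fluctuation integrals);
* **`nextH_line`** — `nextH D (H + σ•U) (K + σV) = nextH D H K + σ • nextH D U V`, i.e. the intermediate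
  Hamiltonian of `T_k` along the line is `H̃ + σŨ` with `H̃ = nextH D H K`, `Ũ = nextH D U V` — the input
  shape of `contDiff_midK_line` / `differentiable_midK_line` (`…HolomorphicMidK`).

All proved, no `sorry`.

## References
* S. Adams, S. Buchholz, R. Kotecký, S. Müller, arXiv:1910.13564, Definition 6.5 (6.16), Theorem 6.8
  (6.55)–(6.57), Definition 8.6 [AdamsBuchholzKoteckyMuller2019].
-/

noncomputable section

-- `Summit.<Summit>.<Problem>`: single-conjunct summit, the duplicate component is mandated (D-0017).
set_option linter.dupNamespace false

namespace Summit.HubbardSuperconductivity.HubbardSuperconductivity.Theorems.ComplexGFF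

open MeasureTheory
open Literature.MathematicalPhysics.StatisticalMechanics.GradientRG
open Literature.MathematicalPhysics.StatisticalMechanics

variable {d M : ℕ} [NeZero M]

/-- `Π₂(σ·F) = σ • Π₂ F` for `C²` functionals. -/
theorem Pi2_const_mul_of_contDiff (c : Fin d → ZMod M) (B : Finset (Fin d → ZMod M))
    {F : ((Fin d → ZMod M) → ℝ) → ℂ} (hF : ContDiff ℝ 2 F) (σ : ℂ) :
    Pi2 c B (fun φ => σ * F φ) = σ • Pi2 c B F := by
  unfold Pi2
  have e : (fun φ => σ * F φ) = σ • F := by funext φ; simp [Pi.smul_apply, smul_eq_mul]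
  rw [e, fderiv_const_smul (hF.differentiable (by norm_num) 0), iteratedFDeriv_const_smul_apply (hF.contDiffAt),
    ← Pi2Data_smul, Pi.smul_apply]

/-- `R(σ·F) = σ·RF`. -/
theorem fluct_const_mul (𝒞 : (Fin d → ZMod M) → ℝ) (F : ((Fin d → ZMod M) → ℝ) → ℂ) (σ : ℂ) :
    fluct 𝒞 (fun φ => σ * F φ) = fun φ => σ * fluct 𝒞 F φ := by
  funext φ
  unfold fluct
  exact integral_const_mul σ _

/-- **`B_k` along an affine line of activities:** `B_k(K + σV) = B_k K + σ • B_k V`. -/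
theorem opB_line (D : StepData d M) {K V : Finset (Fin d → ZMod M) → ((Fin d → ZMod M) → ℝ) → ℂ}
    (hKi : ∀ φ, Integrable (fun ξ => K D.B₀ (φ + ξ)) (stepMeasure D.𝒞))
    (hVi : ∀ φ, Integrable (fun ξ => V D.B₀ (φ + ξ)) (stepMeasure D.𝒞))
    (hKd : ContDiff ℝ 2 (fluct D.𝒞 (K D.B₀))) (hVd : ContDiff ℝ 2 (fluct D.𝒞 (V D.B₀))) (σ : ℂ) :
    opB D (fun Y φ => K Y φ + σ * V Y φ) = opB D K + σ • opB D V := by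
  unfold opB
  beta_reduce
  have e : (fun φ => K D.B₀ φ + σ * V D.B₀ φ) = K D.B₀ + fun φ => σ * V D.B₀ φ := by funext φ; rfl
  have hσVi : ∀ φ, Integrable (fun ξ => (fun φ => σ * V D.B₀ φ) (φ + ξ)) (stepMeasure D.𝒞) :=
    fun φ => (hVi φ).const_mul σ
  rw [e, fluct_add_of_integrable hKi hσVi, fluct_const_mul]
  have hσVd : ContDiff ℝ 2 (fun φ => σ * fluct D.𝒞 (V D.B₀) φ) := contDiff_const.mul hVd
  rw [Pi2_add_of_contDiff D.c₀ D.B₀ hKd hσVd, Pi2_const_mul_of_contDiff D.c₀ D.B₀ hVd σ]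
  rw [neg_add, smul_neg]

/-- **The next Hamiltonian is affine along the line `(H + σU, K + σV)`:**
`nextH D (H + σ•U) (K + σV) = nextH D H K + σ • nextH D U V`. -/
theorem nextH_line (D : StepData d M) (hC : (Matrix.circulant D.𝒞).PosSemidef) (hB : D.B₀.card ≠ 0)
    (hroom : ∀ x ∈ D.B₀, HasRoom D.c₀ x (d / 2 + 1)) (H U : RelevantHamiltonian ℂ d)
    {K V : Finset (Fin d → ZMod M) → ((Fin d → ZMod M) → ℝ) → ℂ}
    (hKi : ∀ φ, Integrable (fun ξ => K D.B₀ (φ + ξ)) (stepMeasure D.𝒞))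
    (hVi : ∀ φ, Integrable (fun ξ => V D.B₀ (φ + ξ)) (stepMeasure D.𝒞))
    (hKd : ContDiff ℝ 2 (fluct D.𝒞 (K D.B₀))) (hVd : ContDiff ℝ 2 (fluct D.𝒞 (V D.B₀))) (σ : ℂ) :
    nextH D (H + σ • U) (fun Y φ => K Y φ + σ * V Y φ) = nextH D H K + σ • nextH D U V := by
  rw [nextH_eq D hC hB hroom, nextH_eq D hC hB hroom, nextH_eq D hC hB hroom, opB_line D hKi hVi hKd hVd σ,
    stepOpA_add, stepOpA_smul, smul_add]
  abel

/-- **Corollary (input shape of `…HolomorphicMidK`):** along the line, the intermediate functional of `T_k` is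
`Φ_σ = midK s (e^{−(H+σU)}) (e^{−(H̃+σŨ)}) (K + σV)` with `H̃ = nextH D H K`, `Ũ = nextH D U V`, hence jointly
`C^n` in `(σ, φ)` and entire in `σ` (for `K, V` blockwise `C^n`). -/
theorem differentiable_midK_nextH_line (D : StepData d M) (hC : (Matrix.circulant D.𝒞).PosSemidef) (hB : D.B₀.card ≠ 0)
    (hroom : ∀ x ∈ D.B₀, HasRoom D.c₀ x (d / 2 + 1)) (H U : RelevantHamiltonian ℂ d)
    {K V : Finset (Fin d → ZMod M) → ((Fin d → ZMod M) → ℝ) → ℂ}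
    (hKi : ∀ φ, Integrable (fun ξ => K D.B₀ (φ + ξ)) (stepMeasure D.𝒞))
    (hVi : ∀ φ, Integrable (fun ξ => V D.B₀ (φ + ξ)) (stepMeasure D.𝒞))
    (hKd : ContDiff ℝ 2 (fluct D.𝒞 (K D.B₀))) (hVd : ContDiff ℝ 2 (fluct D.𝒞 (V D.B₀)))
    (X : Finset (Fin d → ZMod M)) (φ ξ : (Fin d → ZMod M) → ℝ) :
    Differentiable ℂ (fun σ : ℂ =>
      midK D.s (expNegH (H + σ • U)) (expNegH (nextH D (H + σ • U) (fun Y ψ => K Y ψ + σ * V Y ψ)))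
        (fun Y ψ => K Y ψ + σ * V Y ψ) X φ ξ) := by
  have e : ∀ σ : ℂ, nextH D (H + σ • U) (fun Y ψ => K Y ψ + σ * V Y ψ) = nextH D H K + σ • nextH D U V :=
    fun σ => nextH_line D hC hB hroom H U hKi hVi hKd hVd σ
  simp only [e]
  exact differentiable_midK_line D.s H U (nextH D H K) (nextH D U V) K V X φ ξ

end Summit.HubbardSuperconductivity.HubbardSuperconductivity.Theorems.ComplexGFF

end
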